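import Summits.HodgeConjecture.HodgeConjecture.Theses.BoundaryReadout
import Summits.HodgeConjecture.HodgeConjecture.Theses.LinearSystemTorelli
import Summits.HodgeConjecture.HodgeConjecture.Theorems.BoundaryReadoutAbsoluteReductionOfSpreadSection
import Literature.AlgebraicGeometry.HodgeTheory.AbsoluteHodgeClasses
import Literature.AlgebraicGeometry.HodgeTheory.AbsoluteHodgeClassFlatSpread
import Literature.AlgebraicGeometry.HodgeTheory.HodgeLocus
import Literature.AlgebraicGeometry.HodgeTheory.GlobalInvariantCycles
import Literature.AlgebraicGeometry.HodgeTheory.AlgebraicClassesPullback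
import Literature.AlgebraicGeometry.Motives.BaseChange
import HarnessLib

/-!
# Route `BoundaryReadout` — crux `AbsoluteReduction` (stmt-HodgeConjecture-15945):
# the crux CLOSED MODULO NAMED FACTS (Voisin's flat spread ∧ partie fixe ∧ pull-back)

The crux `AbsoluteReduction` (= Voisin 2007, Prop. 1.2, absolute reading: HC over number fields ⟹
every absolute Hodge class on a smooth projective complex variety is algebraic) is here reduced to
THREE inputs, each a theorem in print strictly smaller than Prop. 1.2 itself:

1. `voisin2007_flatSpread_of_isAbsoluteHodgeClass` — the sentence opening Voisin's proof of
   Prop. 1.2 (Compositio 143 (2007), §3, first paragraph, arXiv math/0605766 p. 6): *"there exist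
   smooth irreducible quasi-projective varieties `𝒳, T` defined over `ℚ̄`, a projective morphism
   `π : 𝒳 → T`, and a locally constant global section `α̃ ∈ H⁰(T, R^{2k}π_*ℚ)`, such that `X` is one
   fiber of `π` and `α` is the restriction of `α̃` to this fiber"* — the named Literature fact of
   `Literature/AlgebraicGeometry/HodgeTheory/AbsoluteHodgeClassFlatSpread.lean` on the tree's carriers (a continuous global section of the espace étalé `FiberClass` of
   `R²ᵖ f_* ℂ`); it carries the whole arithmetic content (spreading, Cattani–Deligne–Kaplan /
   Charles–Schnell Thm. 11.3.15–11.3.17: the locus of an absolute class is defined over `ℚ̄` and the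
   class extends flatly over it) and NOTHING of the global invariant cycle theorem;
2. Deligne's global invariant cycle theorem — either the route item
   `LinearSystemTorelli.DeligneGlobalInvariantCycles` (stmt-HodgeConjecture-16363) or, verbatim the
   same body, the Literature fact `deligne_globalInvariantCycles`;
3. pull-back of algebraic classes — either the route item `BoundaryReadout.PullbackAlgebraic`
   (stmt-HodgeConjecture-1071) or the Literature fact `fulton1998_map_mem_algebraicClasses`
   (Fulton, Cor. 19.2).

Everything else is PROVED in the tree and assembled in
`Theorems.absoluteReduction_of_absoluteSpreadSection`
(`Theorems/BoundaryReadoutAbsoluteReductionOfSpreadSection.lean`: Hironaka over `ℚ̄`, the Hodge lift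
through the partie fixe, number-field models of `ℚ̄`-varieties, `HCOverNumberFields`, restriction).

## Main results

* `absoluteReduction_of_flatSpread` — fact 1 → item 16363 → item 1071 → `AbsoluteReduction`;
* `pullbackAlgebraic_of_fulton1998` — fact 3 ⟹ item 1071 (binder reorder);
* `absoluteReduction_of_literatureFacts` — fact 1 → `deligne_globalInvariantCycles` →
  `fulton1998_map_mem_algebraicClasses` → `AbsoluteReduction` (all three hypotheses are named
  Literature facts: the crux is closed modulo the literature debt queue).

All CONDITIONAL (the gate records `conditional-result`s; the item stays open until the facts are
discharged).

## References

* C. Voisin, *Hodge loci and absolute Hodge classes*, Compositio Math. 143 (2007) 945–958, §3,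
  proof of Prop. 1.2, first paragraph; §2, Thm. 2.3 and Lemma 2.4 (arXiv math/0605766, pp. 4–6).
  [Voisin2007HodgeLoci]
* F. Charles, C. Schnell, *Notes on absolute Hodge classes*, in *Hodge Theory* (Math. Notes 49,
  Princeton 2014), Thm. 11.3.15, Cor. 11.3.16, Thm. 11.3.17, Thm. 11.3.19 (= arXiv:1101.3647,
  Thm. 44, 45, 47, 50). [CharlesSchnell2014Notes]
* P. Deligne, *Théorie de Hodge II*, Publ. Math. IHÉS 40 (1971), Thm. 4.1.1. [DeligneHodgeII1971]
* W. Fulton, *Intersection Theory*, 2nd ed. (1998), Cor. 19.2. [Fulton1998]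
-/

-- every declaration of this problem lives in `Summit.HodgeConjecture.HodgeConjecture.…`
-- (single-problem summit: Problem = Summit), which `linter.dupNamespace` flags; set so that
-- stand-alone elaboration is warning-free.
set_option linter.dupNamespace false

noncomputable section

namespace Summit.HodgeConjecture.HodgeConjecture.Theorems

open CategoryTheory AlgebraicGeometry
open Literature.AlgebraicGeometry Literature.AlgebraicGeometry.Motives
open Literature.AlgebraicGeometry.HodgeTheory
open Literature.AlgebraicTopology.SingularHomology
open Summit.HodgeConjecture.HodgeConjecture.Theses

/-- **The crux modulo Voisin's flat spread and the two route items.** `AbsoluteReduction` follows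
from the named fact `voisin2007_flatSpread_of_isAbsoluteHodgeClass`, Deligne's global invariant
cycle theorem (route item stmt-HodgeConjecture-16363) and pull-back of algebraic classes (route item
stmt-HodgeConjecture-1071), by `absoluteReduction_of_absoluteSpreadSection` (Hironaka over `ℚ̄`,
Hodge lift through the partie fixe, number-field model, `HCOverNumberFields`, restriction — all
proved there). CONDITIONAL on the three hypotheses.
[cite: Voisin2007HodgeLoci, §3, proof of Prop. 1.2] [cite: CharlesSchnell2014Notes, Thm. 11.3.19] -/
theorem absoluteReduction_of_flatSpread (hAS : voisin2007_flatSpread_of_isAbsoluteHodgeClass)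
    (hD : LinearSystemTorelli.DeligneGlobalInvariantCycles) (hP : BoundaryReadout.PullbackAlgebraic) :
    BoundaryReadout.AbsoluteReduction :=
  absoluteReduction_of_absoluteSpreadSection hAS hD hP

/-- Fulton's pull-back theorem (the Literature named fact `fulton1998_map_mem_algebraicClasses`,
Fulton 1998 Cor. 19.2) is the route item `PullbackAlgebraic` up to the order of its binders.
[cite: Fulton1998, Cor. 19.2] -/
theorem pullbackAlgebraic_of_fulton1998 (hF : fulton1998_map_mem_algebraicClasses) :
    BoundaryReadout.PullbackAlgebraic := by
  unfold BoundaryReadout.PullbackAlgebraic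
  intro n X hX m W hW ι p c' hc'
  exact hF ι hW hX p c' hc'

/-- The route item `DeligneGlobalInvariantCycles` (stmt-HodgeConjecture-16363) is VERBATIM the body of
the Literature named fact `deligne_globalInvariantCycles` (quasi-projectivity of the base inlined).
[cite: DeligneHodgeII1971, Théorème 4.1.1] -/
theorem deligneGlobalInvariantCycles_of_fact (hD : deligne_globalInvariantCycles) :
    LinearSystemTorelli.DeligneGlobalInvariantCycles :=
  hD

/-- **The crux modulo three named Literature facts.** `AbsoluteReduction` follows from Voisin's
flat spread (`voisin2007_flatSpread_of_isAbsoluteHodgeClass`), Deligne's global invariant cycle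
theorem (`deligne_globalInvariantCycles`, Hodge II Thm. 4.1.1) and Fulton's pull-back of algebraic
classes (`fulton1998_map_mem_algebraicClasses`, Cor. 19.2): the crux is closed modulo the literature
debt queue. CONDITIONAL on the three facts. [cite: Voisin2007HodgeLoci, §3, proof of Prop. 1.2]
[cite: DeligneHodgeII1971, Théorème 4.1.1] [cite: Fulton1998, Cor. 19.2] -/
theorem absoluteReduction_of_literatureFacts (hAS : voisin2007_flatSpread_of_isAbsoluteHodgeClass)
    (hD : deligne_globalInvariantCycles) (hF : fulton1998_map_mem_algebraicClasses) :
    BoundaryReadout.AbsoluteReduction :=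
  absoluteReduction_of_flatSpread hAS (deligneGlobalInvariantCycles_of_fact hD)
    (pullbackAlgebraic_of_fulton1998 hF)

end Summit.HodgeConjecture.HodgeConjecture.Theorems

end
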